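import Literature.AlgebraicGeometry.ShimuraVarieties.UnitaryShimuraComplexFibreGalois
import Literature.AlgebraicGeometry.ShimuraVarieties.UnitaryBallHeckeTranslation
import Literature.AlgebraicGeometry.ShimuraVarieties.HeckeOrbitDensity
import Literature.AlgebraicGeometry.HodgeTheory.ComplexConjugationHolds
import Literature.NumberTheory.Transcendental.AnalytificationMorphismsProofs
import HarnessLib

/-!
# The Hecke translate `[z, aK] ↦ [z, agK']` of Deligne's canonical model is a morphism of the complex
# fibres ([Milne 2005] §13 p. 118 L25–26: «The map `T(g)` is a morphism of algebraic varieties over `ℂ`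
# (because of Theorem 3.14)», for the compact unitary Shimura surface, from the record's `pieces`)

Topic `AlgebraicGeometry/ShimuraVarieties`, namespace `…ShimuraVarieties.UnitaryCanonicalModel`. THEOREMS ONLY
(no definition, no named fact, no `sorry`).

For the v5 record `S : RecordSystem L H τ T hT K₀` of Deligne's canonical model of `Sh(U(H), 𝔹²)`, two small levels
`K, K' ≤ K₀` and `g ∈ U(H)(𝔸_{L⁺,f})` with `g⁻¹Kg ≤ K'`, **there is a morphism `T_ℂ : (M_K)_τ → (M_{K'})_τ` of the
complex fibres over `ℂ` acting on complex points as `[z, aK] ↦ [z, agK']`**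
(`RecordSystem.exists_heckeComplex`). In [Milne2005ShimuraVarieties] this is «because of Theorem 3.14» (Borel,
Baily–Borel); for the record it follows from its own clause (F2c) `pieces`: `(M_K)_τ` is the coproduct of
compact ball quotients `X_q = Γ_H(g_qKg_q⁻¹) \ 𝔹²` (representatives `g_q` of
`Ξ_K = U(H)(L⁺) \ U(H)(𝔸_{L⁺,f}) / K`), uniformised by `z ↦ [z, g_qK]`. On the piece `X_q` choose `γ ∈ U(H)(L⁺)` and
`q'` with `g_q g ∈ φ(γ)⁻¹ g'_{q'} K'` (`exists_rational_rep_mul`); then `[z, g_q g K'] = [γz, g'_{q'} K']`, and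
`z ↦ γ z` descends to the ball quotients because `γ Γ_H(g_qKg_q⁻¹) γ⁻¹ ≤ Γ_H(g'_{q'}K'g'_{q'}⁻¹)`
(`conj_arithmeticLevel_le`, from `g⁻¹Kg ≤ K'`); by the tree's `UnitaryBallHeckeTranslation.exists_hom_map_unif_mulVec_eq`
(«Hecke translations between compact ball quotients are holomorphic, hence morphisms of the models»: Arapura
Cor. 15.4.6, tree theorem `arapura2012_cor_15_4_6_holds`; Hodge models from `exists_isReal_hodgeModel_holds`) this is a
`ℂ`-morphism `X_q → X'_{q'}`, and the pieces glue by the universal property of the coproduct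
(`Cofan.IsColimit.desc`). The point formula is checked piece by piece (`[z, aK] = [x, g_qK]` for suitable `q`, `x`;
`T·lift(γ•x) ∝ γ^τ T·lift(x)`, `mulVec_frame_lift_ratToU21_smul`).

With `UnitaryShimuraHeckeDescent` (Thm. 13.6 by its printed proof) this yields the Hecke translates OVER `L`
(`RecordSystem.exists_heckeTranslate`), i.e. the proof of the named fact `heckeTranslate_definedOver` of
`UnitaryShimuraCanonicalModelHecke`.

## References
* [Milne2005ShimuraVarieties] J. S. Milne, *Introduction to Shimura varieties* (2005; held rev. 2017
  `paper:url-b0e8e4ca1c12`), §13 p. 118 L21–28 (Thm. 13.6), Lemma 5.13 p. 57.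
* [Deligne1979ShimuraVarieties] P. Deligne, *Variétés de Shimura* (1979), 2.1.2–2.1.4 (the pieces `Γ_g \ X⁺`).
* [Arapura2012] D. Arapura, *Algebraic Geometry over the Complex Numbers* (2012), Cor. 15.4.6.
-/

set_option autoImplicit false

noncomputable section

open Function MulAction Topology NumberField IsDedekindDomain CategoryTheory CategoryTheory.Limits Matrix
  AlgebraicGeometry Cardinal
open scoped Matrix ComplexOrder
open Literature.AlgebraicGeometry.Motives
open Literature.NumberTheory.Automorphic Literature.NumberTheory.Automorphic.UnitaryGroup
open Literature.NumberTheory.Automorphic.Liu2021.AppendixC (C5.OpenCompactSubgroup C5.SmallLevel)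
open Literature.Geometry.ComplexHyperbolic Literature.Geometry.ComplexHyperbolic.BallModel
open Literature.NumberTheory.Automorphic.ShimuraDissection
open Literature.AlgebraicGeometry.HodgeTheory (HodgeModel)
open Literature.NumberTheory.Transcendental (arapura2012_cor_15_4_6_holds)

namespace Literature.AlgebraicGeometry.ShimuraVarieties.UnitaryCanonicalModel

variable {L : Type} [Field L] [NumberField L] [IsCMField L] {H : Matrix (Fin 3) (Fin 3) L}
  {τ : L →+* ℂ} {T : GL (Fin 3) ℂ} {hT : formCongr (starRingEnd ℂ) T (H.map τ) = BallModel.J}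
  {K₀ : C5.OpenCompactSubgroup ↥(finAdelic (↥(maximalRealSubfield L)) L (IsCMField.complexConj L) 3 H)}

/-! ### §1. Group-theoretic bookkeeping: representatives, conjugate levels -/

omit [IsCMField L] in
/-- Every double class has the chosen representative up to a rational element: for representatives `g_q` of
`Ξ_K = U(H)(L⁺) \ U(H)(𝔸_f) / K` and any `a`, there is `γ ∈ U(H)(L⁺)` with `(φ(γ) a)⁻¹ g_{[a]} ∈ K`, i.e.
`a K = φ(γ)⁻¹ g_{[a]} K` («`[x, aK] = [γx, g_{[a]}K]`»). [cite: Milne2005ShimuraVarieties, Lemma 5.13 p. 57] -/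
theorem exists_rational_rep {c : L ≃ₐ[↥(maximalRealSubfield L)] L}
    {K : Subgroup (finAdelic (↥(maximalRealSubfield L)) L c 3 H)}
    {gq : orbitRel.Quotient (rational (↥(maximalRealSubfield L)) L c 3 H)
        (CosetSpace (rationalToFinAdelic (↥(maximalRealSubfield L)) L c 3 H) K) →
      finAdelic (↥(maximalRealSubfield L)) L c 3 H}
    (hgq : ∀ q, Quotient.mk'' (CosetSpace.pt (rationalToFinAdelic _ L _ 3 H) K (gq q)) = q)
    (a : finAdelic (↥(maximalRealSubfield L)) L c 3 H) :
    ∃ γ : rational (↥(maximalRealSubfield L)) L c 3 H,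
      (rationalToFinAdelic _ L _ 3 H γ * a)⁻¹ *
          gq (Quotient.mk'' (CosetSpace.pt (rationalToFinAdelic _ L _ 3 H) K a)) ∈ K := by
  have h := hgq (Quotient.mk'' (CosetSpace.pt (rationalToFinAdelic _ L _ 3 H) K a))
  rw [Quotient.eq''] at h
  obtain ⟨γ, hγ⟩ := MulAction.orbitRel_apply.mp h
  refine ⟨γ, ?_⟩
  change CosetSpace.pt (rationalToFinAdelic _ L _ 3 H) K (rationalToFinAdelic _ L _ 3 H γ * a) = _ at hγ
  exact (CosetSpace.pt_eq_pt_iff _ K _ _).mp hγ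

omit [IsCMField L] in
/-- **Conjugating a natural level by a rational element**: if `g⁻¹ K g ≤ K'` and `(φ(γ) b g)⁻¹ b' ∈ K'`, then
`γ · Γ_H(bKb⁻¹) · γ⁻¹ ≤ Γ_H(b'K'b'⁻¹)` — the level condition under which `z ↦ γz` descends to the ball quotients
(`φ(γ) b K b⁻¹ φ(γ)⁻¹ = b' k'⁻¹ g⁻¹ K g k' b'⁻¹ ⊆ b' K' b'⁻¹`). [cite: Milne2005ShimuraVarieties, §13 p. 118 L21–26] -/
theorem conj_arithmeticLevel_le {c : L ≃ₐ[↥(maximalRealSubfield L)] L}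
    {K K' : Subgroup (finAdelic (↥(maximalRealSubfield L)) L c 3 H)}
    {g b b' : finAdelic (↥(maximalRealSubfield L)) L c 3 H}
    (hK : ∀ k ∈ K, g⁻¹ * k * g ∈ K') {γ : rational (↥(maximalRealSubfield L)) L c 3 H}
    (hγ : (rationalToFinAdelic _ L _ 3 H γ * b * g)⁻¹ * b' ∈ K') :
    (arithmeticLevel (↥(maximalRealSubfield L)) L c 3 H (K.map (MulAut.conj b).toMonoidHom)).map
        (MulAut.conj (γ : GL (Fin 3) L)).toMonoidHom ≤
      arithmeticLevel (↥(maximalRealSubfield L)) L c 3 H (K'.map (MulAut.conj b').toMonoidHom) := by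
  rintro _ ⟨δ, hδ, rfl⟩
  rw [SetLike.mem_coe, mem_arithmeticLevel_iff] at hδ
  rw [mem_arithmeticLevel_iff]
  obtain ⟨hδr, hδK⟩ := hδ
  obtain ⟨k, hk, hkδ⟩ := Subgroup.mem_map.mp hδK
  have hγδ : (MulAut.conj (γ : GL (Fin 3) L)).toMonoidHom δ ∈ rational (↥(maximalRealSubfield L)) L c 3 H := by
    change (γ : GL (Fin 3) L) * δ * (γ : GL (Fin 3) L)⁻¹ ∈ _
    exact Subgroup.mul_mem _ (Subgroup.mul_mem _ γ.2 hδr) (Subgroup.inv_mem _ γ.2)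
  refine ⟨hγδ, ?_⟩
  -- name the element `k' := (φ(γ) b g)⁻¹ b' ∈ K'`
  set φ := rationalToFinAdelic (↥(maximalRealSubfield L)) L c 3 H with hφ
  set k' := (φ γ * b * g)⁻¹ * b' with hk'
  have hmapδ : φ ⟨(MulAut.conj (γ : GL (Fin 3) L)).toMonoidHom δ, hγδ⟩ = φ γ * φ ⟨δ, hδr⟩ * (φ γ)⁻¹ := by
    rw [← map_inv, ← map_mul, ← map_mul]
    rfl
  rw [hmapδ, ← hkδ]
  -- `φ(γ) (b k b⁻¹) φ(γ)⁻¹ = b' · k'⁻¹ (g⁻¹ k g) k' · b'⁻¹`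
  have hφγ : φ γ = b' * k'⁻¹ * g⁻¹ * b⁻¹ := by
    rw [hk']
    group
  refine Subgroup.mem_map.mpr ⟨k'⁻¹ * (g⁻¹ * k * g) * k', ?_, ?_⟩
  · exact K'.mul_mem (K'.mul_mem (K'.inv_mem hγ) (hK k hk)) hγ
  · change b' * (k'⁻¹ * (g⁻¹ * k * g) * k') * b'⁻¹ = φ γ * (b * k * b⁻¹) * (φ γ)⁻¹
    rw [hφγ]
    group

/-! ### §2. The frame and the rational action on the ball -/

/-- **`T·lift(γ • x)` is a non-zero multiple of `γ^τ · T·lift(x)`**: the rational element `γ ∈ U(H)(L⁺)` acts on the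
ball through `ρ(γ) = T⁻¹ γ^τ T ∈ U(2,1)` (`ratToU21`, `coe_archProjU21EmbCM_rationalToArch`) by the fractional-linear
action (`BallModel.lift_act`). [cite: Milne2005ShimuraVarieties, Lemma 5.13 p. 57] -/
theorem mulVec_frame_lift_ratToU21_smul (γ : rational (↥(maximalRealSubfield L)) L (IsCMField.complexConj L) 3 H)
    (x : Ball) :
    ∃ c : ℂ, c ≠ 0 ∧
      ((Matrix.GeneralLinearGroup.map τ (γ : GL (Fin 3) L) : GL (Fin 3) ℂ) : Matrix (Fin 3) (Fin 3) ℂ) *ᵥ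
          ((T : Matrix (Fin 3) (Fin 3) ℂ) *ᵥ BallModel.lift x) =
        c • ((T : Matrix (Fin 3) (Fin 3) ℂ) *ᵥ BallModel.lift (ratToU21 L H τ T hT γ • x)) := by
  refine ⟨W3 (ratToU21 L H τ T hT γ) x 2, W3_2_ne_zero _ _, ?_⟩
  rw [BallModel.smul_def, lift_act, mulVec_smul, smul_smul, mul_inv_cancel₀ (W3_2_ne_zero _ _), one_smul]
  change _ = (T : Matrix (Fin 3) (Fin 3) ℂ) *ᵥ (mat (ratToU21 L H τ T hT γ) *ᵥ BallModel.lift x)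
  have hmat : mat (ratToU21 L H τ T hT γ) =
      ((T⁻¹ : GL (Fin 3) ℂ) : Matrix (Fin 3) (Fin 3) ℂ) *
        ((Matrix.GeneralLinearGroup.map τ (γ : GL (Fin 3) L) : GL (Fin 3) ℂ) : Matrix (Fin 3) (Fin 3) ℂ) *
        (T : Matrix (Fin 3) (Fin 3) ℂ) := by
    change (((archProjU21EmbCM L H τ T hT (rationalToArch (↥(maximalRealSubfield L)) L
      (IsCMField.complexConj L) 3 H γ) : U21) : GL (Fin 3) ℂ) : Matrix (Fin 3) (Fin 3) ℂ) = _
    rw [coe_archProjU21EmbCM_rationalToArch, Units.val_mul, Units.val_mul]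
  have hTT : ∀ w : Fin 3 → ℂ, (T : Matrix (Fin 3) (Fin 3) ℂ) *ᵥ (((T⁻¹ : GL (Fin 3) ℂ) : Matrix (Fin 3) (Fin 3) ℂ) *ᵥ w) = w :=
    fun w => by rw [mulVec_mulVec, ← Units.val_mul, mul_inv_cancel, Units.val_one, one_mulVec]
  rw [hmat, ← mulVec_mulVec, ← mulVec_mulVec, hTT]

/-- **Rational elements are isometries of `H^τ`**: `(γ^τ)ᴴ H^τ γ^τ = H^τ` for `γ ∈ U(H)(L⁺)` (the defining equation
`(cγ)ᵀ H γ = H` read through `τ`, `τ ∘ c = conj ∘ τ`). [cite: Milne2005ShimuraVarieties, Lemma 5.13 p. 57] -/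
theorem conjTranspose_map_mul_map (γ : rational (↥(maximalRealSubfield L)) L (IsCMField.complexConj L) 3 H) :
    ((Matrix.GeneralLinearGroup.map τ (γ : GL (Fin 3) L) : GL (Fin 3) ℂ) : Matrix (Fin 3) (Fin 3) ℂ)ᴴ * H.map τ *
        ((Matrix.GeneralLinearGroup.map τ (γ : GL (Fin 3) L) : GL (Fin 3) ℂ) : Matrix (Fin 3) (Fin 3) ℂ) =
      H.map τ := by
  have hmem := map_mem_unitaryGroupOfForm (σ := ((IsCMField.complexConj L : L ≃ₐ[↥(maximalRealSubfield L)] L) :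
      L →+* L)) (τ := starRingEnd ℂ) τ (fun x => IsCMField.complexEmbedding_complexConj L τ x) (J := H) γ.2
  rw [mem_unitaryGroupOfForm_iff] at hmem
  have h2 : ((Matrix.GeneralLinearGroup.map τ (γ : GL (Fin 3) L) : GL (Fin 3) ℂ) : Matrix (Fin 3) (Fin 3) ℂ)ᴴ =
      (((Matrix.GeneralLinearGroup.map τ (γ : GL (Fin 3) L) : GL (Fin 3) ℂ) : Matrix (Fin 3) (Fin 3) ℂ).map
        (starRingEnd ℂ))ᵀ := by
    ext i j
    rfl
  rw [h2]
  exact hmem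

/-! ### §3. The Hecke translate of the complex fibre is a morphism -/

set_option maxHeartbeats 1600000 in -- large adelic / Shimura-set terms: instance-heavy statements
/-- **[Milne2005ShimuraVarieties] §13 p. 118 L25–26 for the record** («The map `T(g)` is a morphism of algebraic
varieties over `ℂ`»): for `g⁻¹Kg ≤ K'` there is a morphism `T_ℂ : (M_K)_τ → (M_{K'})_τ` over `ℂ` of the complex fibres
of Deligne's canonical model acting on complex points as `[z, aK] ↦ [z, agK']` (points read through the record's
`pts` and `AlgPoints.baseChangeEquiv τ`). Built piece by piece on the record's `pieces` cofan from the tree's Hecke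
translations of ball quotients (`UnitaryBallHeckeTranslation.exists_hom_map_unif_mulVec_eq`, Arapura Cor. 15.4.6 =
`arapura2012_cor_15_4_6_holds`) and glued by `Cofan.IsColimit.desc`. [cite: Milne2005ShimuraVarieties, §13 p. 118
L21–26; Lemma 5.13 p. 57] [cite: Deligne1979ShimuraVarieties, 2.1.2–2.1.4] [cite: Arapura2012, §15.4 Cor. 15.4.6] -/
theorem RecordSystem.exists_heckeComplex (S : RecordSystem L H τ T hT K₀) (K K' : C5.SmallLevel K₀)
    (g : finAdelic (↥(maximalRealSubfield L)) L (IsCMField.complexConj L) 3 H)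
    (hK : ∀ k ∈ K.1.1, g⁻¹ * k * g ∈ K'.1.1) :
    letI : Algebra L ℂ := τ.toAlgebra
    ∃ Tc : (Motives.baseChangeHom τ).obj (S.M.obj K) ⟶ (Motives.baseChangeHom τ).obj (S.M.obj K'),
      ∀ (z : Ball) (a : finAdelic (↥(maximalRealSubfield L)) L (IsCMField.complexConj L) 3 H),
        AlgPoints.map Tc (AlgPoints.baseChangeEquiv τ (S.M.obj K)
          ((S.pts K).symm (ShimuraSet.mk L H τ T hT K.1.1 z a))) =
        AlgPoints.baseChangeEquiv τ (S.M.obj K')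
          ((S.pts K').symm (ShimuraSet.mk L H τ T hT K'.1.1 z (a * g))) := by
  letI : Algebra L ℂ := τ.toAlgebra
  classical
  obtain ⟨gq, hgq, X, ι, hcol, B, hB⟩ := S.pieces K
  obtain ⟨gq', hgq', X', ι', hcol', B', hB'⟩ := S.pieces K'
  -- for each piece `q`: the target class `q'` and a rational `γ_q` with `(φ(γ_q) g_q g)⁻¹ g'_{q'} ∈ K'`
  let q' : orbitRel.Quotient (rational (↥(maximalRealSubfield L)) L (IsCMField.complexConj L) 3 H)
      (CosetSpace (rationalToFinAdelic (↥(maximalRealSubfield L)) L (IsCMField.complexConj L) 3 H) K.1.1) → orbitRel.Quotient (rational (↥(maximalRealSubfield L)) L (IsCMField.complexConj L) 3 H)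
      (CosetSpace (rationalToFinAdelic (↥(maximalRealSubfield L)) L (IsCMField.complexConj L) 3 H) K'.1.1) := fun q => Quotient.mk'' (CosetSpace.pt (rationalToFinAdelic (↥(maximalRealSubfield L)) L (IsCMField.complexConj L) 3 H) K'.1.1 (gq q * g))
  have hrep : ∀ q, ∃ γ : rational (↥(maximalRealSubfield L)) L (IsCMField.complexConj L) 3 H,
      (rationalToFinAdelic (↥(maximalRealSubfield L)) L (IsCMField.complexConj L) 3 H γ * (gq q * g))⁻¹ * gq' (q' q) ∈ K'.1.1 := fun q => exists_rational_rep hgq' (gq q * g)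
  choose γ hγ using hrep
  -- Hodge models of the pieces and Arapura's theorem
  have hHM : ∀ q, Nonempty (HodgeModel 2 (X q)) := fun q =>
    let ⟨A, _⟩ := HodgeTheory.exists_isReal_hodgeModel_holds 2 (X q) (B q).isSmoothProjective; ⟨A⟩
  have hHM' : ∀ q, Nonempty (HodgeModel 2 (X' q)) := fun q =>
    let ⟨A, _⟩ := HodgeTheory.exists_isReal_hodgeModel_holds 2 (X' q) (B' q).isSmoothProjective; ⟨A⟩
  -- the piece morphisms `X_q ⟶ X'_{q'}`, `[v] ↦ [γ_q^τ v]`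
  have hpiece : ∀ q, ∃ f : X q ⟶ X' (q' q), ∀ v ∈ (B q).cone, AlgPoints.map f ((B q).unif v) =
      (B' (q' q)).unif (((Matrix.GeneralLinearGroup.map τ ((γ q : rational _ L _ 3 H) : GL (Fin 3) L) :
        GL (Fin 3) ℂ) : Matrix (Fin 3) (Fin 3) ℂ) *ᵥ v) := by
    intro q
    obtain ⟨hH1, hΓ1, -⟩ := hB q
    obtain ⟨hH2, hΓ2, -⟩ := hB' (q' q)
    refine UnitaryBallHeckeTranslation.exists_hom_map_unif_mulVec_eq_of_nonempty arapura2012_cor_15_4_6_holds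
      (hHM q) (hHM' (q' q)) ?_ ?_
    · rw [hH1, hH2]
      exact conjTranspose_map_mul_map (τ := τ) (γ q)
    · rw [hΓ1, hΓ2, Subgroup.map_map]
      have hcomm : ((MulAut.conj (Matrix.GeneralLinearGroup.map τ ((γ q : rational _ L _ 3 H) : GL (Fin 3) L))).toMonoidHom).comp
          (Matrix.GeneralLinearGroup.map τ) =
        (Matrix.GeneralLinearGroup.map (n := Fin 3) τ).comp
          (MulAut.conj ((γ q : rational _ L _ 3 H) : GL (Fin 3) L)).toMonoidHom := by
        ext δ i j
        simp [MulAut.conj_apply, map_mul, map_inv]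
      rw [hcomm, ← Subgroup.map_map]
      apply Subgroup.map_mono
      have hγq := hγ q
      rw [← mul_assoc] at hγq
      exact conj_arithmeticLevel_le (K := K.1.1) (K' := K'.1.1) hK hγq
  choose f hf using hpiece
  -- glue along the coproduct
  refine ⟨Cofan.IsColimit.desc hcol fun q => f q ≫ ι' (q' q), fun z a => ?_⟩
  -- the point `[z, aK]` lies on the piece of `q = [a]`: `[z, aK] = [x, g_q K]` with `x = ρ(δ) • z`
  obtain ⟨δ, hδ⟩ := exists_rational_rep hgq a
  set q : orbitRel.Quotient (rational (↥(maximalRealSubfield L)) L (IsCMField.complexConj L) 3 H)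
      (CosetSpace (rationalToFinAdelic (↥(maximalRealSubfield L)) L (IsCMField.complexConj L) 3 H) K.1.1) := Quotient.mk'' (CosetSpace.pt (rationalToFinAdelic (↥(maximalRealSubfield L)) L (IsCMField.complexConj L) 3 H) K.1.1 a) with hqdef
  set x : Ball := ratToU21 L H τ T hT δ • z with hx
  have hza : ShimuraSet.mk L H τ T hT K.1.1 z a = ShimuraSet.mk L H τ T hT K.1.1 x (gq q) := by
    refine (ShimuraSet.mk_eq_mk_iff L H τ T hT K.1.1 _ _ _ _).mpr ⟨δ⁻¹, ?_, ?_⟩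
    · rw [hx, smul_smul, ← map_mul, inv_mul_cancel, map_one, one_smul]
    · simpa only [map_inv, _root_.mul_inv_rev, mul_assoc] using hδ
  have hza' : ShimuraSet.mk L H τ T hT K'.1.1 z (a * g) = ShimuraSet.mk L H τ T hT K'.1.1 x (gq q * g) := by
    refine (ShimuraSet.mk_eq_mk_iff L H τ T hT K'.1.1 _ _ _ _).mpr ⟨δ⁻¹, ?_, ?_⟩
    · rw [hx, smul_smul, ← map_mul, inv_mul_cancel, map_one, one_smul]
    · have h := hK _ hδ
      simpa only [map_inv, _root_.mul_inv_rev, mul_assoc, inv_inv] using h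
  -- `[x, g_q g K'] = [ρ(γ_q) • x, g'_{q'} K']`
  have hxq : ShimuraSet.mk L H τ T hT K'.1.1 x (gq q * g) =
      ShimuraSet.mk L H τ T hT K'.1.1 (ratToU21 L H τ T hT (γ q) • x) (gq' (q' q)) := by
    refine (ShimuraSet.mk_eq_mk_iff L H τ T hT K'.1.1 _ _ _ _).mpr ⟨(γ q)⁻¹, ?_, ?_⟩
    · rw [smul_smul, ← map_mul, inv_mul_cancel, map_one, one_smul]
    · have h := hγ q
      simpa only [map_inv, _root_.mul_inv_rev, mul_assoc, inv_inv] using h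
  rw [hza, hza', hxq]
  -- read both sides through the pieces
  have hcone : (T : Matrix (Fin 3) (Fin 3) ℂ) *ᵥ BallModel.lift x ∈ (B q).cone := by
    change _ ∈ negCone (B q).Hℂ
    rw [(hB q).1]
    exact frame_mulVec_lift_mem_negCone hT x
  have hcone' : (T : Matrix (Fin 3) (Fin 3) ℂ) *ᵥ BallModel.lift (ratToU21 L H τ T hT (γ q) • x) ∈
      (B' (q' q)).cone := by
    change _ ∈ negCone (B' (q' q)).Hℂ
    rw [(hB' (q' q)).1]
    exact frame_mulVec_lift_mem_negCone hT _
  obtain ⟨c, hc, hcx⟩ := mulVec_frame_lift_ratToU21_smul (hT := hT) (γ q) x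
  rw [← (hB q).2.2 x, ← (hB' (q' q)).2.2, ← AlgPoints.map_comp_apply]
  change AlgPoints.map ((Cofan.mk _ ι).inj q ≫ Cofan.IsColimit.desc hcol fun q => f q ≫ ι' (q' q)) _ = _
  rw [Cofan.IsColimit.fac, AlgPoints.map_comp_apply, hf q _ hcone, hcx, (B' (q' q)).unif_smul hc hcone']

end Literature.AlgebraicGeometry.ShimuraVarieties.UnitaryCanonicalModel

end
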